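import Mathlib

/-!
# Stub `stub_thicknessFit` — crux `DissociatedFixedK` (stmt-ValiantsHypothesis-5907), line
`annihilator-product-functional`

Blueprint step 3 of the crux
`Summit.ValiantsHypothesis.ValiantsHypothesis.Theses.NewtonUnitEquations.DissociatedFixedK`
(route NewtonUnitEquations): the "thickness `< k`" bound at a strictly exposed surviving frame word,
obtained from ONE annihilating product functional on a two-letter sub-cube.

* §0 the lever: `productFunctional_rankOne`, `exists_annihilator`, `thickness_of_annihilator`;
* §1 the fit to the crux's data: `stub_thicknessFit`.

Only Mathlib is used; no dissociation and no genericity of the functional `l` are needed here.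
[folklore; KPTT arXiv:1308.2286 §2 for the setting]
-/

namespace Summit.ValiantsHypothesis.Theorems.DissociatedFixedK

open scoped BigOperators Classical
open Finset

noncomputable section

/-! ## §0  The lever: the annihilating product functional -/

/-- The product functional `Λ_λ(h) = Σ_y (Π_j λ_j(y_j)) h(y)` on functions of the Boolean cube factors
on a rank-one function: `Λ_λ(⊗ ψ_j) = Π_j (λ_j(0)ψ_j(0) + λ_j(1)ψ_j(1))`. [folklore] -/
theorem productFunctional_rankOne {J : Type*} [Fintype J] [DecidableEq J]
    (lam ψ : J → Bool → ℂ) :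
    ∑ y : J → Bool, (∏ j, lam j (y j)) * ∏ j, ψ j (y j)
      = ∏ j, (lam j false * ψ j false + lam j true * ψ j true) := by
  have h := Finset.prod_univ_sum (fun _ : J => (Finset.univ : Finset Bool))
    (fun j b => lam j b * ψ j b)
  simp only [Fintype.piFinset_univ] at h
  have h' : ∀ j : J, (∑ b : Bool, lam j b * ψ j b)
      = lam j false * ψ j false + lam j true * ψ j true := by
    intro j
    rw [Fintype.sum_bool]
    ring
  simp only [h'] at h
  rw [h]
  refine Finset.sum_congr rfl fun y _ => ?_
  rw [← Finset.prod_mul_distrib]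

/-- Existence of the annihilating product functional: `λ_j = (0,1)` on one dead coordinate per dead
live term, `λ_{ι i} = (φ_i(1), -φ_i(0))` along an injection `ι` of the alive terms into the other
coordinates (it exists because `k ≤ |J|`). [folklore] -/
theorem exists_annihilator {k : ℕ} {J : Type*} [Fintype J] [DecidableEq J]
    (x : Fin k → ℂ) (φ : Fin k → J → Bool → ℂ)
    (hstruct : ∀ i, x i = 0 ∨ (∀ j, φ i j false ≠ 0) ∨ (∃ j, φ i j true = 0))
    (hk : k ≤ Fintype.card J) :
    ∃ lam : J → Bool → ℂ, (∀ j, lam j true ≠ 0) ∧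
      ∀ i, x i = 0 ∨ ∃ j, lam j false * φ i j false + lam j true * φ i j true = 0 := by
  classical
  rcases isEmpty_or_nonempty J with hJ | hJ
  · refine ⟨fun _ _ => 1, fun j => one_ne_zero, fun i => ?_⟩
    have : Fintype.card J = 0 := Fintype.card_eq_zero
    exact absurd i.2 (by omega)
  -- dead terms and a dead coordinate for each
  let dead : Finset (Fin k) := Finset.univ.filter fun i => x i ≠ 0 ∧ ∃ j, φ i j true = 0
  have hdead : ∀ i ∈ dead, ∃ j, φ i j true = 0 := fun i hi => (Finset.mem_filter.1 hi).2.2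
  choose! jd hjd using hdead
  let D : Finset J := dead.image jd
  let alive : Finset (Fin k) := Finset.univ.filter fun i => x i ≠ 0 ∧ ∀ j, φ i j true ≠ 0
  have halive_false : ∀ i ∈ alive, ∀ j, φ i j false ≠ 0 := by
    intro i hi j
    have hi' := (Finset.mem_filter.1 hi).2
    rcases hstruct i with h0 | hf | ⟨j', hj'⟩
    · exact absurd h0 hi'.1
    · exact hf j
    · exact absurd hj' (hi'.2 j')
  have hdisj : Disjoint alive dead := by
    rw [Finset.disjoint_left]
    intro i h1 h2
    obtain ⟨j, hj⟩ := (Finset.mem_filter.1 h2).2.2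
    exact (Finset.mem_filter.1 h1).2.2 j hj
  have hcard1 : alive.card + dead.card ≤ k := by
    rw [← Finset.card_union_of_disjoint hdisj]
    exact (Finset.card_le_univ _).trans (by simp)
  have hD : D.card ≤ dead.card := Finset.card_image_le
  have hDJ : D.card ≤ Fintype.card J := (Finset.card_le_univ D)
  have hcard2 : alive.card ≤ Fintype.card J - D.card := by omega
  -- an embedding of the alive terms into the non-dead coordinates
  have hemb : Nonempty (alive ↪ (Finset.univ \ D : Finset J)) := by
    apply Function.Embedding.nonempty_of_card_le
    rw [Fintype.card_coe, Fintype.card_coe, Finset.card_sdiff_of_subset (Finset.subset_univ D),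
      Finset.card_univ]
    exact hcard2
  obtain ⟨e⟩ := hemb
  have key : ∀ (a : alive)
      (h : ∃ a' : alive, ((e a' : (Finset.univ \ D : Finset J)) : J)
        = ((e a : (Finset.univ \ D : Finset J)) : J)),
      h.choose = a := by
    intro a h
    exact e.injective (Subtype.ext h.choose_spec)
  have heD : ∀ a : alive, ((e a : (Finset.univ \ D : Finset J)) : J) ∉ D :=
    fun a => (Finset.mem_sdiff.1 (e a).2).2
  -- the functional's factors, with their three evaluation rules
  obtain ⟨lam, hlamD, hlamA, hlamO⟩ : ∃ lam : J → Bool → ℂ,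
      (∀ j ∈ D, lam j = fun b => cond b 1 0) ∧
      (∀ a : alive, lam ((e a : (Finset.univ \ D : Finset J)) : J)
        = fun b => cond b (-(φ (a : Fin k) ((e a : (Finset.univ \ D : Finset J)) : J) false))
            (φ (a : Fin k) ((e a : (Finset.univ \ D : Finset J)) : J) true)) ∧
      (∀ j ∉ D, (¬ ∃ a : alive, ((e a : (Finset.univ \ D : Finset J)) : J) = j) →
        lam j = fun b => cond b 1 0) := by
    refine ⟨fun j => if hj : j ∈ D then (fun b => cond b 1 0)
      else if h : ∃ a : alive, ((e a : (Finset.univ \ D : Finset J)) : J) = j then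
        (fun b => cond b (-(φ (h.choose : Fin k) j false)) (φ (h.choose : Fin k) j true))
      else (fun b => cond b 1 0), ?_, ?_, ?_⟩
    · intro j hj
      simp only [dif_pos hj]
    · intro a
      have h : ∃ a' : alive, ((e a' : (Finset.univ \ D : Finset J)) : J)
          = ((e a : (Finset.univ \ D : Finset J)) : J) := ⟨a, rfl⟩
      simp only [dif_neg (heD a), dif_pos h]
      rw [key a h]
    · intro j hj hne
      simp only [dif_neg hj, dif_neg hne]
  refine ⟨lam, ?_, ?_⟩
  · intro j
    by_cases hjD : j ∈ D
    · rw [hlamD j hjD]; exact one_ne_zero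
    · by_cases h : ∃ a : alive, ((e a : (Finset.univ \ D : Finset J)) : J) = j
      · obtain ⟨a, rfl⟩ := h
        rw [hlamA a]
        exact neg_ne_zero.2 (halive_false _ a.2 _)
      · rw [hlamO j hjD h]; exact one_ne_zero
  · intro i
    by_cases hx : x i = 0
    · exact Or.inl hx
    right
    by_cases hdi : ∃ j, φ i j true = 0
    · -- dead term: its chosen coordinate lies in D and λ = (0,1) there
      have hi : i ∈ dead := Finset.mem_filter.2 ⟨Finset.mem_univ _, hx, hdi⟩
      refine ⟨jd i, ?_⟩
      have hjD : jd i ∈ D := Finset.mem_image_of_mem jd hi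
      rw [hlamD _ hjD, hjd i hi]
      simp
    · -- alive term: use the coordinate e ⟨i, _⟩
      push Not at hdi
      have hi : i ∈ alive := Finset.mem_filter.2 ⟨Finset.mem_univ _, hx, hdi⟩
      refine ⟨((e ⟨i, hi⟩ : (Finset.univ \ D : Finset J)) : J), ?_⟩
      rw [hlamA ⟨i, hi⟩]
      simp only [cond_true, cond_false]
      ring

/-- **Dual-witness thickness on the two-letter sub-cube** (the lever).  `x i` = value of term
`i` outside the deviation coordinates `J`; `φ i j true` = coefficient at the survivor's letter `a j`,
`φ i j false` = coefficient at the box letter `b j`.  Structure hypothesis: every term is negligible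
(`x i = 0`), alive at the `false` corner, or dead at the `true` corner in some coordinate.  All cube
points other than the all-`true` corner are cancelled, the corner itself survives ⇒ `|J| < k`.
[folklore] -/
theorem thickness_of_annihilator {k : ℕ} {J : Type*} [Fintype J] [DecidableEq J]
    (x : Fin k → ℂ) (φ : Fin k → J → Bool → ℂ)
    (hstruct : ∀ i, x i = 0 ∨ (∀ j, φ i j false ≠ 0) ∨ (∃ j, φ i j true = 0))
    (hzero : ∀ y : J → Bool, y ≠ (fun _ => true) → ∑ i, x i * ∏ j, φ i j (y j) = 0)
    (htop : ∑ i, x i * ∏ j, φ i j true ≠ 0) :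
    Fintype.card J < k := by
  classical
  by_contra hk
  push Not at hk
  obtain ⟨lam, hlam1, hlam2⟩ := exists_annihilator x φ hstruct hk
  -- the functional applied to g, computed two ways
  let g : (J → Bool) → ℂ := fun y => ∑ i, x i * ∏ j, φ i j (y j)
  have way1 : ∑ y : J → Bool, (∏ j, lam j (y j)) * g y = (∏ j, lam j true) * g (fun _ => true) := by
    rw [Finset.sum_eq_single (fun _ => true)]
    · intro y _ hy
      rw [show g y = 0 from hzero y hy, mul_zero]
    · intro h; exact absurd (Finset.mem_univ _) h
  have way2 : ∑ y : J → Bool, (∏ j, lam j (y j)) * g y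
      = ∑ i, x i * ∏ j, (lam j false * φ i j false + lam j true * φ i j true) := by
    have : ∀ y : J → Bool, (∏ j, lam j (y j)) * g y
        = ∑ i, x i * ((∏ j, lam j (y j)) * ∏ j, φ i j (y j)) := by
      intro y
      simp only [g, Finset.mul_sum]
      refine Finset.sum_congr rfl fun i _ => ?_
      ring
    simp only [this]
    rw [Finset.sum_comm]
    refine Finset.sum_congr rfl fun i _ => ?_
    rw [← Finset.mul_sum, productFunctional_rankOne]
  have hvan : ∑ i, x i * ∏ j, (lam j false * φ i j false + lam j true * φ i j true) = 0 := by
    refine Finset.sum_eq_zero fun i _ => ?_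
    rcases hlam2 i with h0 | ⟨j, hj⟩
    · rw [h0, zero_mul]
    · rw [Finset.prod_eq_zero (Finset.mem_univ j) hj, mul_zero]
  have hprod : (∏ j, lam j true) ≠ 0 := Finset.prod_ne_zero_iff.2 fun j _ => hlam1 j
  have : (∏ j, lam j true) * g (fun _ => true) = 0 := by rw [← way1, way2, hvan]
  rcases mul_eq_zero.1 this with h | h
  · exact hprod h
  · exact htop h

/-! ## §1  Thickness at a vertex — the lever fitted to the crux's data -/

/-- **stub_thicknessFit** — blueprint step 3 by the annihilating product functional (this line's
lever).  `c i j e` is an abstract coefficient tensor (for the crux: `coeff e (f i j)`), `a` the strict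
`l`-top surviving word, `b` a word of the frame that is letterwise `l`-above `a` (`hba`) and alive in
every coordinate for every product alive at `a` (`hbI`).  Then `b` and `a` differ in `< k` places.
Proof: on the sub-cube `Π_{j ∈ J} {a j, b j} × Π_{j ∉ J} {a j}`, `J = {j : b j ≠ a j}`, every word
other than `a` is a frame word (`ha`, `hb`), `l`-≥ `a` (additivity of `l ∘ emb` over letters, `hba`)
and `≠ a`, hence has `T = 0` by `htop`; with `x i = Π_{j∉J} c i j (a j)`, `φ i j true = c i j (a j)`,
`φ i j false = c i j (b j)` the trichotomy of `thickness_of_annihilator` holds (`hbI` for alive terms;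
a term dead at `a` is dead inside `J` or has `x i = 0`), and that theorem gives `card J < k`.
No dissociation and no genericity of `l` are needed. [folklore] -/
theorem stub_thicknessFit {k m : ℕ} (A : Fin m → Finset (Fin 2 →₀ ℕ))
    (c : Fin k → Fin m → (Fin 2 →₀ ℕ) → ℂ) (l : (Fin 2 → ℝ) →L[ℝ] ℝ)
    (a b : Fin m → (Fin 2 →₀ ℕ)) (ha : ∀ j, a j ∈ A j) (hb : ∀ j, b j ∈ A j)
    (hTa : (∑ i, ∏ j, c i j (a j)) ≠ 0)
    (htop : ∀ a' : Fin m → (Fin 2 →₀ ℕ), (∀ j, a' j ∈ A j) → a' ≠ a →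
      (∑ i, ∏ j, c i j (a' j)) ≠ 0 →
      l (fun i : Fin 2 => (((∑ j, a' j) i : ℕ) : ℝ)) < l (fun i : Fin 2 => (((∑ j, a j) i : ℕ) : ℝ)))
    (hbI : ∀ i, (∀ j, c i j (a j) ≠ 0) → ∀ j, c i j (b j) ≠ 0)
    (hba : ∀ j, l (fun i : Fin 2 => (((a j) i : ℕ) : ℝ)) ≤ l (fun i : Fin 2 => (((b j) i : ℕ) : ℝ))) :
    (Finset.univ.filter fun j => b j ≠ a j).card < k := by
  classical
  set J : Finset (Fin m) := Finset.univ.filter fun j => b j ≠ a j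
  -- sub-cube data: value outside `J`, two letters inside `J` (`true ↦ a j`, `false ↦ b j`)
  let x : Fin k → ℂ := fun i => ∏ j ∈ Jᶜ, c i j (a j)
  let φ : Fin k → ↥J → Bool → ℂ := fun i j y => c i j (cond y (a j) (b j))
  -- the grid word of a cube corner
  let wd : (↥J → Bool) → Fin m → (Fin 2 →₀ ℕ) := fun y j =>
    if h : j ∈ J then cond (y ⟨j, h⟩) (a j) (b j) else a j
  have hwdA : ∀ y j, wd y j ∈ A j := by
    intro y j
    simp only [wd]
    split_ifs with h
    · rcases Bool.eq_false_or_eq_true (y ⟨j, h⟩) with hy | hy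
      · rw [hy]; exact ha j
      · rw [hy]; exact hb j
    · exact ha j
  -- tensor value at a corner = the cube expression
  have hT : ∀ y, (∑ i, ∏ j, c i j (wd y j)) = ∑ i, x i * ∏ j : ↥J, φ i j (y j) := by
    intro y
    refine Finset.sum_congr rfl fun i _ => ?_
    rw [← Finset.prod_mul_prod_compl J (fun j => c i j (wd y j)), mul_comm]
    congr 1
    · show ∏ j ∈ Jᶜ, c i j (wd y j) = ∏ j ∈ Jᶜ, c i j (a j)
      refine Finset.prod_congr rfl fun j hj => ?_
      have hj' : j ∉ J := Finset.mem_compl.1 hj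
      simp only [wd, dif_neg hj']
    · show ∏ j ∈ J, c i j (wd y j) = ∏ j : ↥J, φ i j (y j)
      rw [← Finset.prod_coe_sort J]
      refine Finset.prod_congr rfl fun j _ => ?_
      simp only [wd, φ, dif_pos j.2, Subtype.coe_eta]
  -- `l ∘ emb` is additive over the letters of a word
  have e1 : ∀ w : Fin m → (Fin 2 →₀ ℕ),
      l (fun i : Fin 2 => (((∑ j, w j) i : ℕ) : ℝ)) = ∑ j, l (fun i : Fin 2 => (((w j) i : ℕ) : ℝ)) := by
    intro w
    have e0 : (fun i : Fin 2 => (((∑ j, w j) i : ℕ) : ℝ))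
        = ∑ j, (fun i : Fin 2 => (((w j) i : ℕ) : ℝ)) := by
      funext i
      simp only [Finsupp.coe_finsetSum, Finset.sum_apply, Nat.cast_sum]
    rw [e0, map_sum]
  -- every corner other than the all-`true` corner is cancelled
  have hzero : ∀ y : ↥J → Bool, y ≠ (fun _ => true) → ∑ i, x i * ∏ j : ↥J, φ i j (y j) = 0 := by
    intro y hy
    rw [← hT y]
    by_contra hne
    -- the corner word differs from `a`
    have hwa : wd y ≠ a := by
      intro heq
      obtain ⟨j, hj⟩ := Function.ne_iff.1 hy
      have hyj : y j = false := by simpa using hj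
      have h1 := congrFun heq j
      simp only [wd, dif_pos j.2, Subtype.coe_eta, hyj, cond_false] at h1
      exact (Finset.mem_filter.1 j.2).2 h1
    -- but it is `l`-at-least `a`
    have hge : l (fun i : Fin 2 => (((∑ j, a j) i : ℕ) : ℝ))
        ≤ l (fun i : Fin 2 => (((∑ j, wd y j) i : ℕ) : ℝ)) := by
      rw [e1 a, e1 (wd y)]
      refine Finset.sum_le_sum fun j _ => ?_
      by_cases hj : j ∈ J
      · simp only [wd, dif_pos hj]
        rcases Bool.eq_false_or_eq_true (y ⟨j, hj⟩) with hy' | hy'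
        · rw [hy']; exact le_rfl
        · rw [hy']; exact hba j
      · simp only [wd, dif_neg hj]
        exact le_rfl
    exact absurd (htop (wd y) (hwdA y) hwa hne) (not_lt.2 hge)
  -- the all-`true` corner is `a` itself and survives
  have hwtrue : wd (fun _ => true) = a := by
    funext j
    by_cases hj : j ∈ J
    · simp only [wd, dif_pos hj, cond_true]
    · simp only [wd, dif_neg hj]
  have htop' : ∑ i, x i * ∏ j : ↥J, φ i j true ≠ 0 := by
    have h := (hT (fun _ => true)).symm
    simp only [hwtrue] at h
    rw [h]
    exact hTa
  -- trichotomy: negligible / alive at the `false` corner / dead at the `true` corner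
  have hstruct : ∀ i, x i = 0 ∨ (∀ j : ↥J, φ i j false ≠ 0) ∨ (∃ j : ↥J, φ i j true = 0) := by
    intro i
    by_cases hal : ∀ j, c i j (a j) ≠ 0
    · exact Or.inr (Or.inl fun j => hbI i hal j)
    · push Not at hal
      obtain ⟨j₀, hj₀⟩ := hal
      by_cases hjJ : j₀ ∈ J
      · exact Or.inr (Or.inr ⟨⟨j₀, hjJ⟩, hj₀⟩)
      · exact Or.inl (Finset.prod_eq_zero (Finset.mem_compl.2 hjJ) hj₀)
  have hlt := thickness_of_annihilator x φ hstruct hzero htop'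
  rwa [Fintype.card_coe] at hlt

end

end Summit.ValiantsHypothesis.Theorems.DissociatedFixedK
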